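import Mathlib.Probability.Moments.Covariance
import Summits.Ventures.YMGap.Thresholds.SharpClusteringDecay
import Summits.Ventures.YMGap.Thresholds.RegionPoincare
import Literature.Probability.LatticeModels.SharpnessProofs
import HarnessLib

/-!
# Venture YMGap — static exponential clustering, Part IV-c (OBJECT U2):
# exponential decay of covariances under the DLR kernels `γ_E(·|η)`, uniformly in `E` and `η`

HONEST FRAMING: venture file (cell `pub-ymgap`, track (a), seat lit-1). Lattice, strong coupling
('t Hooft `|β| < 1/(2Λ₀)`, `Λ₀` a REGION Hessian constant of the tree, `RegionWilsonHessianBound d N Λ₀`);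
nothing about the continuum. This is the region-kernel twin of `SharpClusteringTorus`: the generic
decay estimate `cov_exp_decay_of_distFun` (Part III-b) instantiated with seat p2's kernel potential
`regionPot E η β` on `SU(N)^E` (`regionPot_mem_polySpace`, `hessBound_regionPot`,
`integral_ymSpecification_eq_div`, file `RegionPoincare`). The termwise cross-link Hessian bound of
the kernel potential (`OffDiagHessBound (regionPot E η β) h` with `h ≥ 0` symmetric, row sums
`≤ 6(d-1)N|β|`, supported on pairs of links whose base points are `≤ 1` apart in the sup-norm of `ℤ^d`)
enters as HYPOTHESIS binders (OBJECT U1, seat ds-2), so this file is gate-independent of it.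

Result (`kernel_covariance_exp_decay`, signature (T_E) of the cell bus): there is
`κ = κ(d,N,β,Λ₀) = min 1 (K/(4H₊+1)) > 0`, `K = N/2 - N|β|Λ₀`, `H₊ = max(6(d-1)N|β|, 0)`, such that for
every finite edge set `E`, every exterior configuration `η`, every such `h`, all smooth `u, v` on
`(E → M_N(ℂ))` with per-link Lipschitz data `δu, δv ≥ 0` on `SU(N)^E` carried by links whose base
points are `≥ m` apart,
`|Cov_{γ_E(·|η)}(u,v)| ≤ (2/K) e^{-κ m} (Σ_e δu_e)(Σ_e δv_e)` — uniformly in `E`, `η`.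
Downstream (OBJECT U3/U4, seats p2/p1): boundary-insensitivity of the kernels and DLR uniqueness.

## References

* H. Shen, R. Zhu, X. Zhu, CMP 400 (2023) 805–851, Cor. 4.11 (torus version; the kernel version is
  the same argument for the conditional measures).
-/

noncomputable section

open scoped Matrix ComplexConjugate BigOperators Matrix.Norms.Frobenius ContDiff Topology ProbabilityTheory
open Matrix Complex Finset MeasureTheory Filter ProbabilityTheory
open Literature.MathematicalPhysics.QuantumFieldTheory
open Literature.MathematicalPhysics.QuantumLattice (fundamentalRep continuous_fundamentalRep LGConfig ymSpecification isProbabilityMeasure_ymSpecification)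
open Literature.Probability.LatticeModels (glueWith glueWith_apply_mem Site)
open Literature.MathematicalPhysics.QuantumFieldTheory.SUNBakryEmery (SUN)

namespace Summit.Ventures.YMGap

namespace SharpClustering

open LatticeBakryEmery

variable {d N : ℕ}

/-! ### The sup-norm of `ℤ^d` -/

/-- `‖x - x‖_∞ = 0` (the triangle inequality `‖x - z‖_∞ ≤ ‖x - y‖_∞ + ‖y - z‖_∞` is the tree's
`Site.supNorm_add_le` after `sub_add_sub_cancel`; it is used inline below). -/
theorem supNorm_sub_self (x : Site d) : Site.supNorm (x - x) = 0 := by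
  rw [sub_self]
  simp [Site.supNorm]

/-! ### Kernel expectations as `e^{regionPot}`-weighted Haar averages: the covariance -/

/-- The covariance of two smooth cylinder functions on `E` under the kernel `γ_E(·|η)`, in
unnormalised form (`S = regionPot E η β`, `Z = ∫ e^S dσ^{⊗E}`). -/
theorem covariance_ymSpecification_eq (E : Finset (Literature.MathematicalPhysics.QuantumFieldTheory.ZdEdge d))
    (η : LGConfig d (SUN N)) (β : ℝ) {u v : Cfg ↥E N → ℝ} (hu : ContDiff ℝ ∞ u) (hv : ContDiff ℝ ∞ v) :
    cov[matrixCylinder E u, matrixCylinder E v; ymSpecification (fundamentalRep (Fin N)) ((N : ℝ) * β) E η] =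
      ((∫ ζ, Real.exp (regionPot E η β (emb ζ)) ∂(haarPi ↥E N)) *
          (∫ ζ, Real.exp (regionPot E η β (emb ζ)) * (u (emb ζ) * v (emb ζ)) ∂(haarPi ↥E N)) -
        (∫ ζ, Real.exp (regionPot E η β (emb ζ)) * u (emb ζ) ∂(haarPi ↥E N)) *
          (∫ ζ, Real.exp (regionPot E η β (emb ζ)) * v (emb ζ) ∂(haarPi ↥E N))) /
        (∫ ζ, Real.exp (regionPot E η β (emb ζ)) ∂(haarPi ↥E N)) ^ 2 := by
  set γ := ymSpecification (fundamentalRep (Fin N)) ((N : ℝ) * β) E η with hγ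
  haveI : IsProbabilityMeasure γ :=
    isProbabilityMeasure_ymSpecification (fundamentalRep (Fin N)) (continuous_fundamentalRep (Fin N)) ((N : ℝ) * β) E η
  set Z : ℝ := ∫ ζ, Real.exp (regionPot E η β (emb ζ)) ∂(haarPi ↥E N) with hZ
  have hSc : Continuous fun ζ : PSU ↥E N => regionPot E η β (emb ζ) := continuous_restrict (contDiff_regionPot E η β)
  have hZpos : 0 < Z := integral_exp_pos (integrable_of_continuous_PSU (Real.continuous_exp.comp hSc) _)
  -- cylinder functions: continuity, boundedness, values on glued configurations
  have hcts : ∀ {f : Cfg ↥E N → ℝ}, ContDiff ℝ ∞ f → Continuous (matrixCylinder E f) := fun hf => by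
    refine hf.continuous.comp ?_
    exact continuous_pi fun e => continuous_subtype_val.comp (continuous_apply _)
  have hglue : ∀ (f : Cfg ↥E N → ℝ) (ζ : PSU ↥E N), matrixCylinder E f (glueWith E ζ η) = f (emb ζ) := by
    intro f ζ
    simp only [matrixCylinder]
    congr 1
    funext e
    rw [glueWith_apply_mem E ζ η e.2, emb_apply]
  have hval : ∀ (f : Cfg ↥E N → ℝ) (U : LGConfig d (SUN N)),
      matrixCylinder E f U = f (emb fun e : ↥E => U (e : Literature.MathematicalPhysics.QuantumFieldTheory.ZdEdge d)) := by
    intro f U; rfl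
  obtain ⟨Cu, -, hCu⟩ := exists_bound_restrict (ι := ↥E) hu
  obtain ⟨Cv, -, hCv⟩ := exists_bound_restrict (ι := ↥E) hv
  have hmu : MemLp (matrixCylinder E u) 2 γ :=
    MemLp.of_bound (hcts hu).aestronglyMeasurable Cu
      (ae_of_all _ fun U => by rw [Real.norm_eq_abs, hval]; exact hCu _)
  have hmv : MemLp (matrixCylinder E v) 2 γ :=
    MemLp.of_bound (hcts hv).aestronglyMeasurable Cv
      (ae_of_all _ fun U => by rw [Real.norm_eq_abs, hval]; exact hCv _)
  rw [covariance_eq_sub hmu hmv]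
  have e1 : ∫ U, (matrixCylinder E u * matrixCylinder E v) U ∂γ =
      (∫ ζ, Real.exp (regionPot E η β (emb ζ)) * (u (emb ζ) * v (emb ζ)) ∂(haarPi ↥E N)) / Z := by
    rw [hγ, integral_ymSpecification_eq_div E η β (F := matrixCylinder E u * matrixCylinder E v)
      ((hcts hu).mul (hcts hv))]
    simp only [Pi.mul_apply, hglue]
    rfl
  have e2 : ∫ U, matrixCylinder E u U ∂γ = (∫ ζ, Real.exp (regionPot E η β (emb ζ)) * u (emb ζ) ∂(haarPi ↥E N)) / Z := by
    rw [hγ, integral_ymSpecification_eq_div E η β (hcts hu)]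
    simp only [hglue]
    rfl
  have e3 : ∫ U, matrixCylinder E v U ∂γ = (∫ ζ, Real.exp (regionPot E η β (emb ζ)) * v (emb ζ) ∂(haarPi ↥E N)) / Z := by
    rw [hγ, integral_ymSpecification_eq_div E η β (hcts hv)]
    simp only [hglue]
    rfl
  rw [e1, e2, e3]
  field_simp

/-! ### The kernel theorem -/

/-- **Exponential decay of kernel covariances from an abstract distance function** (region twin of
`torus_cov_le_of_distFun`): `D : E → ℕ` with `h e e' ≠ 0 → D e ≤ D e' + 1`, `D = 0` on `v`'s links,
`D ≥ m` on `u`'s links. -/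
theorem kernel_cov_le_of_distFun {Λ₀ : ℝ} (hH : RegionWilsonHessianBound d N Λ₀) (hN : N ≠ 0) (β : ℝ)
    (hK : 0 < (N : ℝ) / 2 - N * |β| * Λ₀)
    (E : Finset (Literature.MathematicalPhysics.QuantumFieldTheory.ZdEdge d)) (η : LGConfig d (SUN N))
    {h : ↥E → ↥E → ℝ} (hOff : OffDiagHessBound (regionPot E η β) h) (hh0 : ∀ e e', 0 ≤ h e e')
    (hsymm : ∀ e e', h e e' = h e' e) (hrow : ∀ e, ∑ e', h e e' ≤ 6 * ((d : ℝ) - 1) * N * |β|)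
    {u v : Cfg ↥E N → ℝ} (hu : ContDiff ℝ ∞ u) (hv : ContDiff ℝ ∞ v)
    {δu δv : ↥E → ℝ} (hδu : ∀ e, 0 ≤ δu e) (hδv : ∀ e, 0 ≤ δv e)
    (hLu : LinkLipschitz u δu) (hLv : LinkLipschitz v δv)
    (D : ↥E → ℕ) (hD : ∀ e e', h e e' ≠ 0 → D e ≤ D e' + 1)
    (hDv : ∀ e, δv e ≠ 0 → D e = 0) {m : ℕ} (hDu : ∀ e, δu e ≠ 0 → m ≤ D e) :
    |cov[matrixCylinder E u, matrixCylinder E v; ymSpecification (fundamentalRep (Fin N)) ((N : ℝ) * β) E η]| ≤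
      2 / ((N : ℝ) / 2 - N * |β| * Λ₀) *
        Real.exp (-(min 1 (((N : ℝ) / 2 - N * |β| * Λ₀) / (4 * max (6 * ((d : ℝ) - 1) * N * |β|) 0 + 1))) * m) *
        (∑ e, δu e) * (∑ e, δv e) := by
  set Hp : ℝ := max (6 * ((d : ℝ) - 1) * N * |β|) 0 with hHp
  have hHp0 : 0 ≤ Hp := le_max_right _ _
  set S := regionPot E η β with hS
  have hSc : Continuous fun ζ : PSU ↥E N => S (emb ζ) := continuous_restrict (contDiff_regionPot E η β)
  set Z : ℝ := ∫ ζ, Real.exp (S (emb ζ)) ∂(haarPi ↥E N) with hZ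
  have hZpos : 0 < Z := integral_exp_pos (integrable_of_continuous_PSU (Real.continuous_exp.comp hSc) _)
  have hgen := cov_exp_decay_of_distFun (ι := ↥E) hN (regionPot_mem_polySpace E η β)
    (hessBound_regionPot hH E η β) hK hOff hh0 hsymm hHp0 (fun e => (hrow e).trans (le_max_left _ _)) D hD
    hu hv hδu hδv hLu hLv hDv hDu
  rw [covariance_ymSpecification_eq E η β hu hv, abs_div, abs_of_pos (pow_pos hZpos 2), div_le_iff₀ (pow_pos hZpos 2)]
  refine hgen.trans (le_of_eq ?_)
  ring

/-- **Exponential decay of covariances under the DLR kernels, uniformly in the region and the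
boundary condition** (signature (T_E)). -/
theorem kernel_covariance_exp_decay {d N : ℕ} {Λ₀ : ℝ} (hH : RegionWilsonHessianBound d N Λ₀) (hN : N ≠ 0) (β : ℝ)
    (hK : 0 < (N : ℝ) / 2 - N * |β| * Λ₀) :
    ∃ κ : ℝ, 0 < κ ∧ ∀ (E : Finset (Literature.MathematicalPhysics.QuantumFieldTheory.ZdEdge d))
      (η : LGConfig d (SUN N)) (h : ↥E → ↥E → ℝ),
      OffDiagHessBound (regionPot E η β) h → (∀ e e', 0 ≤ h e e') → (∀ e e', h e e' = h e' e) →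
      (∀ e, ∑ e', h e e' ≤ 6 * ((d : ℝ) - 1) * N * |β|) →
      (∀ e e', h e e' ≠ 0 → Site.supNorm (e.1.1 - e'.1.1) ≤ 1) →
      ∀ (u v : Cfg ↥E N → ℝ), ContDiff ℝ ∞ u → ContDiff ℝ ∞ v →
      ∀ (δu δv : ↥E → ℝ), (∀ e, 0 ≤ δu e) → (∀ e, 0 ≤ δv e) →
        LinkLipschitz u δu → LinkLipschitz v δv →
      ∀ (m : ℕ), (∀ e e', δu e ≠ 0 → δv e' ≠ 0 → m ≤ Site.supNorm (e.1.1 - e'.1.1)) →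
        |cov[matrixCylinder E u, matrixCylinder E v; ymSpecification (fundamentalRep (Fin N)) ((N : ℝ) * β) E η]| ≤
          2 / ((N : ℝ) / 2 - N * |β| * Λ₀) * Real.exp (-κ * m) * (∑ e, δu e) * (∑ e, δv e) := by
  set K : ℝ := (N : ℝ) / 2 - N * |β| * Λ₀ with hKdef
  set Hp : ℝ := max (6 * ((d : ℝ) - 1) * N * |β|) 0 with hHp
  have hHp0 : 0 ≤ Hp := le_max_right _ _
  refine ⟨min 1 (K / (4 * Hp + 1)), rate_pos hK hHp0, ?_⟩
  intro E η h hOff hh0 hsymm hrow hfin u v hu hv δu δv hδu hδv hLu hLv m hsep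
  classical
  set Sv : Finset ↥E := univ.filter fun e => δv e ≠ 0 with hSv
  by_cases hne : Sv.Nonempty
  · set D : ↥E → ℕ := fun e => Sv.inf' hne fun e' => Site.supNorm (e.1.1 - e'.1.1) with hD
    have hD1 : ∀ e e', h e e' ≠ 0 → D e ≤ D e' + 1 := by
      intro e e' he'
      obtain ⟨s, hs, hDs⟩ := exists_mem_eq_inf' hne (fun e'' : ↥E => Site.supNorm (e'.1.1 - e''.1.1))
      have h1 : D e ≤ Site.supNorm (e.1.1 - s.1.1) := inf'_le _ hs
      have h2 : Site.supNorm (e.1.1 - s.1.1) ≤ Site.supNorm (e.1.1 - e'.1.1) + Site.supNorm (e'.1.1 - s.1.1) := by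
        have h := Site.supNorm_add_le (e.1.1 - e'.1.1) (e'.1.1 - s.1.1)
        rwa [sub_add_sub_cancel] at h
      have h3 := hfin e e' he'
      have h4 : D e' = Site.supNorm (e'.1.1 - s.1.1) := hDs
      omega
    have hDv : ∀ e, δv e ≠ 0 → D e = 0 := by
      intro e he
      have hmem : e ∈ Sv := by rw [hSv]; exact mem_filter.2 ⟨mem_univ _, he⟩
      have h1 : D e ≤ Site.supNorm (e.1.1 - e.1.1) := inf'_le _ hmem
      rw [supNorm_sub_self] at h1
      exact Nat.le_zero.1 h1
    have hDu : ∀ e, δu e ≠ 0 → m ≤ D e := by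
      intro e he
      refine (le_inf'_iff hne _).2 fun e' he' => ?_
      have h1 : e' ∈ univ.filter (fun e => δv e ≠ 0) := by rw [hSv] at he'; exact he'
      exact hsep e e' he (mem_filter.1 h1).2
    exact kernel_cov_le_of_distFun hH hN β hK E η hOff hh0 hsymm hrow hu hv hδu hδv hLu hLv D hD1 hDv hDu
  · have hδv0 : ∀ e, δv e = 0 := by
      intro e
      by_contra hc
      exact hne ⟨e, by rw [hSv]; exact mem_filter.2 ⟨mem_univ _, hc⟩⟩
    have h0 := kernel_cov_le_of_distFun hH hN β hK E η hOff hh0 hsymm hrow hu hv hδu hδv hLu hLv (fun _ => 0)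
      (fun _ _ _ => by simp) (fun _ _ => rfl) (m := 0) (fun _ _ => le_rfl)
    have hs0 : ∑ e, δv e = 0 := sum_eq_zero fun e _ => hδv0 e
    rw [hs0, mul_zero] at h0 ⊢
    exact h0

end SharpClustering

end Summit.Ventures.YMGap
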